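import Mathlib.LinearAlgebra.Eigenspace.Semisimple
import Mathlib.LinearAlgebra.Eigenspace.Minpoly
import Mathlib.LinearAlgebra.Semisimple
import Mathlib.LinearAlgebra.Dual.Lemmas
import Mathlib.LinearAlgebra.FiniteDimensional.Lemmas
import Mathlib.RingTheory.PrincipalIdealDomain
import Mathlib.Order.Atoms
import Literature.NumberTheory.GaloisRepresentations.AdequateSubgroup
import HarnessLib

/-!
# Extended adequate subgroups of `GL_n(k)` (Guralnick–Herzig–Tiep 2017, §1; Thorne, Math. Z. 2017, Def. 2.20)

Topic `NumberTheory/GaloisRepresentations`.  Let `k` be a field of characteristic `p` and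
`H ≤ GL_n(k) = GL(V)`, `V = kⁿ`; `ad = End(V) = M_{n×n}(k)` with the adjoint (conjugation) action of
`H` (the tree's `glAdjointRepresentation`), `Z = k · 1 ⊆ ad` the line of scalar matrices (an
`H`-invariant subspace) and `ad₀ = ad / Z` (Thorne's notation, §1.1: "`ad₀ ρ̄` for the quotient of
`ad ρ̄` by the `Γ`-invariant subspace of scalar endomorphisms"; NOT the trace-zero matrices `ad⁰`,
the tree's `adZero`).  The *extended* notion of adequacy — the one that allows `p ∣ n` and `p = 2`,
in contrast with Thorne's 2012 notion `Subgroup.IsThorneAdequate` (`AdequateSubgroup.lean`, which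
asks `H⁰(H, ad⁰) = 0` and hence fails whenever `p ∣ n`, `Subgroup.not_isThorneAdequate_of_natCast_eq_zero`)
— is printed in two forms.

Guralnick–Herzig–Tiep, *Adequate subgroups and indecomposable modules*, JEMS 19 (2017), §1
(arXiv:1405.0043, p. 3), as printed ("let `k` be a field of characteristic `p` and let `V` be a
finite dimensional vector space over `k`. Let `ρ : G → GL(V)` be an absolutely irreducible
representation … Recently Thorne [T2] has shown that one can relax the condition that
`p ∤ dim V` … So more generally, we say that an absolutely irreducible representation
`ρ : G → GL(V)` is *adequate* if:"):

> • `H¹(G, k) = 0`;  • `H¹(G, (V* ⊗ V)/k) = 0`;  • `End(V)` is spanned by the elements `ρ(g)`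
> with `ρ(g)` semisimple.

("Note that we allow the case `p = 2` in the definition. Thorne has used this extended notion of
adequacy to prove an automorphy lifting theorem for `2`-adic Galois representations of unitary type
over imaginary CM fields, see [T2].")

Thorne, *A 2-adic automorphy lifting theorem for unitary groups over CM fields*, Math. Z. 285
(2017), Def. 2.20, as printed ("The following definition of adequate subgroups is taken from [13]"
= GHT):

> Definition 2.20. Let `K` be a field. We say that a subgroup `H ⊂ GL_n(K)` is *adequate* if it
> satisfies the following conditions: (i) We have `H¹(H, K) = 0` and `H¹(H, ad₀) = 0`.  (ii) For
> each simple `K[H]`-submodule `W ⊂ ad`, there exists a semi-simple element `σ ∈ H` with an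
> eigenvalue `α ∈ K` such that `tr e_{σ,α} W ≠ 0`.

> The second condition implies that `M_n(K)` is spanned as a `K`-vector space by the semi-simple
> elements `σ ∈ H ⊂ ad`. In particular, an adequate subgroup acts absolutely irreducibly in its
> tautological representation on `Kⁿ`.

This is hypothesis (ii) of Thorne's Thm. 5.1 (= Thm. 1.1, automorphy lifting for `p`-adic
representations of unitary type, any `p`, any `n ≥ 2`): "The group `ρ̄(G_{F(ζ_p)}) ⊂ GL_n(𝔽̄_p)` is
adequate, in the sense of Definition 2.20."  Requested by item `defn-ExtendedAdequate` for the line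
`thorne-minimal-lift` of crux `stmt-Langlands-13757` (`p = n = 3`, image `S₄`, where the 2012 notion
fails formally but GHT Thm. 1.7 gives extended adequacy).

## Main definitions

* `scalarMatrices n k : Submodule k (Matrix n n k)` — **`Z`**, the scalar matrices `k · 1`
  (Mathlib `k ∙ 1 = (1 : Submodule k (Matrix n n k))`, `scalarMatrices_eq_one`); stable under the
  adjoint action (indeed fixed, `glAdjointRepresentation_apply_of_mem_scalarMatrices`).
* `adModScalar n k : Representation k (GL n k) (Matrix n n k ⧸ scalarMatrices n k)` — **`ad₀ = ad/Z`**
  (Mathlib `Representation.quotient`), and for a subgroup `H ≤ GL_n(k)` the restrictions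
  `Subgroup.adRep H` (of `ad`) and `Subgroup.adModScalarRep H` (of `ad₀`).
* `Subgroup.semisimpleSpan H : Submodule k (Matrix (Fin n) (Fin n) k)` — GHT's `𝓜 = ⟨g ∈ H | g`
  semisimple`⟩_k` (§2, p. 5), the `k`-span of the semisimple elements of `H` (semisimple = "of order
  prime to `p`", see Design).
* `Subgroup.IsExtendedAdequate H` — **`H ≤ GL_n(k)` is adequate in the extended sense of GHT 2017,
  §1** (the three clauses verbatim): (i) `H¹(H, k) = 0` for the trivial action, i.e. every additive
  homomorphism `H → k` is zero (Mathlib `groupCohomology.H1IsoOfIsTrivial`: `H¹ ≅ Hom` for trivial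
  coefficients, see `IsExtendedAdequate.subsingleton_H1_trivial`); (ii) `H¹(H, ad/Z) = 0`: every
  inhomogeneous `1`-cocycle `H → ad₀` is a `1`-coboundary (Mathlib `groupCohomology.cocycles₁ ≤
  coboundaries₁`, i.e. `H¹ = 0`, see `IsExtendedAdequate.subsingleton_H1`); (iii) `semisimpleSpan H = ⊤`.
* `Subgroup.IsThorne2017Adequate H` — **Thorne's printed Def. 2.20**: (i) as (i)+(ii) above;
  (ii) for every simple `k[H]`-submodule `W ⊆ ad` (an atom of the lattice
  `Subrepresentation (Subgroup.adRep H)`) there are `h ∈ H` semisimple, `α ∈ k` and `w ∈ W` with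
  `tr(e_{h,α} w) ≠ 0` (`eigenprojectionMatrix` of `AdequateSubgroup.lean`; `α` is then automatically
  an eigenvalue of `h`, `hasEigenvalue_of_trace_eigenprojectionMatrix_mul_ne_zero`).  Thorne's remark
  that (ii) implies clause (iii) of GHT is `IsThorne2017Adequate.semisimpleSpan_eq_top` /
  `IsThorne2017Adequate.isExtendedAdequate`; conversely `IsExtendedAdequate.isThorne2017Adequate`
  when every semisimple element of `H` is diagonalisable over `k`, so that over an algebraically
  closed `k` (e.g. `𝔽̄_p`, the setting of Thm. 5.1) the two structures agree
  (`Subgroup.isThorne2017Adequate_iff_isExtendedAdequate`).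
* `FramedRep.HasExtendedAdequateImage ρ` — dot-form for a framed representation
  `ρ : G →ₜ* GL_n(k)`: the image `ρ(G) ≤ GL_n(k)` is adequate in the extended (GHT) sense.
* API: unfolding lemmas; the `H¹` statements in Mathlib's `groupCohomology.H1`; an elementwise form
  of clause (ii) (`cocycles₁_le_coboundaries₁_iff_forall`); "in particular, an adequate subgroup acts
  absolutely irreducibly": the commutant of `H` in `M_n(k)` is `Z` and `H⁰(H, ad) = Z`
  (`mem_scalarMatrices_of_forall_commute`, `IsExtendedAdequate.invariants_adRep_eq`); the linear
  algebra behind the bridge: `e_{f,α}` is a polynomial in `f` (`exists_eigenprojection_eq_aeval`,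
  via Bézout on the minimal polynomial), the spectral decomposition `f = ∑ μ e_{f,μ}` of a
  diagonalisable `f` (`exists_eq_sum_smul_eigenprojection`), simple subrepresentations below a
  non-zero one (`Subrepresentation.exists_isAtom_le`), non-vanishing of the trace-orthogonal of a
  proper subspace (`Subgroup.exists_ne_zero_semisimpleSpan_orth`), and diagonalisability of
  `p`-regular elements over `k = k̄` (`iSup_eigenspace_eq_top_of_coprime_orderOf`, Mathlib
  `Module.End.isSemisimple_of_squarefree_aeval_eq_zero`, `IsSemisimple.iSup_eigenspace_eq_top`).

## Design

* As for `Subgroup.IsThorneAdequate` and `Subgroup.IsEnormous`, absolute irreducibility (GHT: "an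
  absolutely irreducible representation `ρ` … is adequate if") is the standing hypothesis, not a
  clause, and is NOT built in — for the extended notion it is moreover a consequence of clause (iii)
  (Thorne's remark; `IsExtendedAdequate.invariants_adRep_eq` gives `End_{k[H]}(V) = k`).
* "Semisimple" is taken, as in `AdequateSubgroup.lean`, in the printed GHTT sense "semisimple, i.e.
  of order prime to `l`" (appendix to Thorne 2012, Lemma 1): `(orderOf h).Coprime (ringChar k)` — so
  `h` has finite order prime to `p = ringChar k`; for an element of finite order of `GL_n(k)`,
  `char k = p > 0`, this is equivalent to being diagonalisable over `k̄`.  This is the case of the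
  requester (`H` the finite image of a residual Galois representation) and of all of GHT's theorems
  (`G` finite).  Intended for `ringChar k = p` prime; in characteristic `0` only `h = 1` qualifies and
  the notion degenerates, as does the whole theory.
  -- TODO(general form): Thorne's Def. 2.20 is stated for an arbitrary field `K` and an arbitrary
  subgroup `H`, "semi-simple" meaning diagonalisable over `K̄`; for elements of infinite order the
  clause here is more restrictive.
* Group cohomology is Mathlib's inhomogeneous-cochain model for the bundled `Rep.of (…)`, exactly as
  in `EnormousSubgroup.lean` / `AdequateSubgroup.lean` (`k` and `H` live in the same universe).
* NOT here (each a separate result, none needed to STATE the notions): GHT's remarks "if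
  `p ∤ dim V`, `k` is a direct summand of `V* ⊗ V`" (comparison with the 2012 notion) and "if
  `H²(G,k) = 0` then …"; GHT Thm. 1.7 (degree `p`) and Thorne's Thm. 5.1 (requested separately as
  facts `wi-37169`, `wi-37170`); the `S₄ < GL₃(𝔽₃)` example of the requester; the converse bridge
  over a non-closed `k` missing eigenvalues of elements of `H`.

## References

* [GuralnickHerzigTiep2017] R. Guralnick, F. Herzig, P. H. Tiep, *Adequate subgroups and
  indecomposable modules*, JEMS 19 (2017) 1231–1291, §1 (definition of adequate, extended sense),
  §2 (the span `𝓜`) (held: arXiv:1405.0043, pp. 3, 5; read 2026-08-17).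
* [Thorne2017TwoAdic] J. A. Thorne, *A 2-adic automorphy lifting theorem for unitary groups over CM
  fields*, Math. Z. 285 (2017) 1–38, §1.1 (notation `ad`, `ad⁰`, `ad₀`), Def. 2.20, Thm. 5.1 (ii)
  (held: doi:10.1007/s00209-016-1681-2; Def. 2.20 read 2026-08-17 from the publisher's full text).
* [Thorne2012] J. Thorne, *On the automorphy of `l`-adic Galois representations with small residual
  image*, J. Inst. Math. Jussieu 11 (2012), Def. 2.3 and appendix (GHTT) Lemma 1 — the 2012 notion,
  `AdequateSubgroup.lean`.
-/

noncomputable section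

open scoped MatrixGroups

namespace Literature.NumberTheory.GaloisRepresentations

universe u

/-! ### Scalar matrices and `ad₀ = ad / Z` -/

section Adjoint

variable (n : Type) [DecidableEq n] (k : Type u) [Field k]

/-- **`Z ⊆ ad`**: the line `k · 1` of scalar matrices in `M_{n×n}(k)` ("the `Γ`-invariant subspace of
scalar endomorphisms"), as a `k`-submodule (Mathlib `k ∙ 1`, which is `(1 : Submodule k (M_n k))`,
`scalarMatrices_eq_one`). [cite: Thorne2017TwoAdic, §1.1 (Notation)] -/
def scalarMatrices : Submodule k (Matrix n n k) :=
  k ∙ (1 : Matrix n n k)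

variable {n k} in
/-- Membership in `Z`: `M` is scalar iff `M = c • 1` for some `c ∈ k`. [folklore] -/
theorem mem_scalarMatrices_iff (M : Matrix n n k) :
    M ∈ scalarMatrices n k ↔ ∃ c : k, c • (1 : Matrix n n k) = M :=
  Submodule.mem_span_singleton

variable {n} in
/-- `c • 1 ∈ Z`. [folklore] -/
theorem smul_one_mem_scalarMatrices (c : k) : c • (1 : Matrix n n k) ∈ scalarMatrices n k :=
  (mem_scalarMatrices_iff _).2 ⟨c, rfl⟩

variable [Fintype n]

/-- `Z` is Mathlib's `1 : Submodule k (M_n k)` (the range of `algebraMap k (M_n k)`). [folklore] -/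
theorem scalarMatrices_eq_one : scalarMatrices n k = (1 : Submodule k (Matrix n n k)) :=
  Submodule.one_eq_span.symm

variable {n k} in
/-- The adjoint action fixes the scalar matrices: `g (c • 1) g⁻¹ = c • 1`. [folklore] -/
theorem glAdjointRepresentation_apply_of_mem_scalarMatrices (g : GL n k) {M : Matrix n n k}
    (hM : M ∈ scalarMatrices n k) : glAdjointRepresentation n k g M = M := by
  obtain ⟨c, rfl⟩ := (mem_scalarMatrices_iff M).1 hM
  rw [glAdjointRepresentation_apply, Matrix.mul_smul, Matrix.mul_one, Matrix.smul_mul,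
    Units.mul_inv]

/-- `Z` is stable under the adjoint action (the hypothesis of Mathlib's `Representation.quotient`).
[folklore] -/
theorem scalarMatrices_le_comap (g : GL n k) :
    scalarMatrices n k ≤ (scalarMatrices n k).comap (glAdjointRepresentation n k g) := fun M hM =>
  Submodule.mem_comap.2 (by rwa [glAdjointRepresentation_apply_of_mem_scalarMatrices g hM])

/-- **`ad₀ = ad / Z`**: the adjoint representation of `GL_n(k)` on `M_{n×n}(k)` modulo the scalar
matrices (Mathlib `Representation.quotient`). [cite: Thorne2017TwoAdic, §1.1 (Notation), Def. 2.20] -/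
def adModScalar : Representation k (GL n k) (Matrix n n k ⧸ scalarMatrices n k) :=
  (glAdjointRepresentation n k).quotient (scalarMatrices n k) (scalarMatrices_le_comap n k)

variable {n k} in
/-- Unfolding lemma: on `ad₀`, `g • [M] = [g M g⁻¹]`. [folklore] -/
@[simp] theorem adModScalar_apply_mk (g : GL n k) (M : Matrix n n k) :
    adModScalar n k g (Submodule.Quotient.mk M) =
      Submodule.Quotient.mk (((g : GL n k) : Matrix n n k) * M * ((g⁻¹ : GL n k) : Matrix n n k)) :=
  rfl

end Adjoint

/-! ### The representations of a subgroup on `ad` and `ad₀`; the span of its semisimple elements -/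

section Subgroup

variable {k : Type u} [Field k] {n : ℕ}

/-- The representation of a subgroup `H ≤ GL_n(k)` on **`ad = M_{n×n}(k)`** (restriction of the
adjoint action).  Declared as `….GaloisRepresentations.Subgroup.adRep` (topic namespace, not
Mathlib's `Subgroup`). [cite: Thorne2017TwoAdic, Def. 2.20] -/
abbrev Subgroup.adRep (H : Subgroup (GL (Fin n) k)) :
    Representation k H (Matrix (Fin n) (Fin n) k) :=
  (glAdjointRepresentation (Fin n) k).comp H.subtype

/-- Unfolding lemma: `h ∈ H` acts on `M ∈ ad` by `h M h⁻¹`. [folklore] -/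
@[simp] theorem Subgroup.adRep_apply (H : Subgroup (GL (Fin n) k)) (h : H)
    (M : Matrix (Fin n) (Fin n) k) :
    Subgroup.adRep H h M =
      (((h : GL (Fin n) k)) : Matrix (Fin n) (Fin n) k) * M *
        ((((h : GL (Fin n) k))⁻¹ : GL (Fin n) k) : Matrix (Fin n) (Fin n) k) :=
  rfl

/-- The representation of a subgroup `H ≤ GL_n(k)` on **`ad₀ = ad / Z`** (restriction of
`adModScalar`): the coefficient module of clause (ii), `H¹(H, ad/Z)`.
[cite: Thorne2017TwoAdic, Def. 2.20] -/
abbrev Subgroup.adModScalarRep (H : Subgroup (GL (Fin n) k)) :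
    Representation k H (Matrix (Fin n) (Fin n) k ⧸ scalarMatrices (Fin n) k) :=
  (adModScalar (Fin n) k).comp H.subtype

/-- Unfolding lemma: `h ∈ H` acts on `[M] ∈ ad₀` by `[h M h⁻¹]`. [folklore] -/
@[simp] theorem Subgroup.adModScalarRep_apply_mk (H : Subgroup (GL (Fin n) k)) (h : H)
    (M : Matrix (Fin n) (Fin n) k) :
    Subgroup.adModScalarRep H h (Submodule.Quotient.mk M) =
      Submodule.Quotient.mk ((((h : GL (Fin n) k)) : Matrix (Fin n) (Fin n) k) * M *
        ((((h : GL (Fin n) k))⁻¹ : GL (Fin n) k) : Matrix (Fin n) (Fin n) k)) :=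
  rfl

/-- The quotient map `ad → ad₀` intertwines the two actions of `h ∈ H`. [folklore] -/
theorem Subgroup.adModScalarRep_apply_mkQ (H : Subgroup (GL (Fin n) k)) (h : H)
    (M : Matrix (Fin n) (Fin n) k) :
    Subgroup.adModScalarRep H h ((scalarMatrices (Fin n) k).mkQ M) =
      (scalarMatrices (Fin n) k).mkQ (Subgroup.adRep H h M) :=
  rfl

/-- **`𝓜 = ⟨g ∈ H | g semisimple⟩_k`**: the `k`-span in `M_{n×n}(k)` of the semisimple elements of
`H` — "semisimple" in the printed GHTT sense "of order prime to `p`", `p = ringChar k` (module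
docstring, Design). [cite: GuralnickHerzigTiep2017, §2 (notation `𝓜`, arXiv p. 5)] -/
def Subgroup.semisimpleSpan (H : Subgroup (GL (Fin n) k)) :
    Submodule k (Matrix (Fin n) (Fin n) k) :=
  Submodule.span k {M | ∃ h : H, (orderOf (h : GL (Fin n) k)).Coprime (ringChar k) ∧
    (((h : GL (Fin n) k)) : Matrix (Fin n) (Fin n) k) = M}

/-- Unfolding lemma for `Subgroup.semisimpleSpan`. [folklore] -/
theorem Subgroup.semisimpleSpan_def (H : Subgroup (GL (Fin n) k)) :
    Subgroup.semisimpleSpan H =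
      Submodule.span k {M | ∃ h : H, (orderOf (h : GL (Fin n) k)).Coprime (ringChar k) ∧
        (((h : GL (Fin n) k)) : Matrix (Fin n) (Fin n) k) = M} :=
  rfl

/-- A semisimple (order prime to `p`) element of `H` lies in `𝓜`. [folklore] -/
theorem Subgroup.mem_semisimpleSpan_of_coprime (H : Subgroup (GL (Fin n) k)) (h : H)
    (hh : (orderOf (h : GL (Fin n) k)).Coprime (ringChar k)) :
    (((h : GL (Fin n) k)) : Matrix (Fin n) (Fin n) k) ∈ Subgroup.semisimpleSpan H :=
  Submodule.subset_span ⟨h, hh, rfl⟩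

/-- `1 ∈ 𝓜` (the identity has order `1`). [folklore] -/
theorem Subgroup.one_mem_semisimpleSpan (H : Subgroup (GL (Fin n) k)) :
    (1 : Matrix (Fin n) (Fin n) k) ∈ Subgroup.semisimpleSpan H := by
  have h := Subgroup.mem_semisimpleSpan_of_coprime H 1 (by simp)
  simpa using h

/-- `Z ⊆ 𝓜`. [folklore] -/
theorem Subgroup.scalarMatrices_le_semisimpleSpan (H : Subgroup (GL (Fin n) k)) :
    scalarMatrices (Fin n) k ≤ Subgroup.semisimpleSpan H := by
  rw [scalarMatrices, Submodule.span_singleton_le_iff_mem]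
  exact Subgroup.one_mem_semisimpleSpan H

/-- `𝓜` is stable under conjugation by `H` (conjugation preserves orders), i.e. it is a
`k[H]`-submodule of `ad`. [folklore] -/
theorem Subgroup.adRep_apply_mem_semisimpleSpan (H : Subgroup (GL (Fin n) k)) (g : H)
    {M : Matrix (Fin n) (Fin n) k} (hM : M ∈ Subgroup.semisimpleSpan H) :
    Subgroup.adRep H g M ∈ Subgroup.semisimpleSpan H := by
  rw [Subgroup.semisimpleSpan] at hM ⊢
  refine Submodule.span_induction (p := fun M _ => Subgroup.adRep H g M ∈ _) ?_ ?_ ?_ ?_ hM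
  · rintro _ ⟨h, hh, rfl⟩
    refine Submodule.subset_span ⟨g * h * g⁻¹, ?_, ?_⟩
    · have e : ((g * h * g⁻¹ : H) : GL (Fin n) k) =
          (g : GL (Fin n) k) * (h : GL (Fin n) k) * (g : GL (Fin n) k)⁻¹ := by
        simp
      have hsc : SemiconjBy (g : GL (Fin n) k) (h : GL (Fin n) k)
          ((g : GL (Fin n) k) * (h : GL (Fin n) k) * (g : GL (Fin n) k)⁻¹) := by
        rw [SemiconjBy, inv_mul_cancel_right]
      rwa [e, ← hsc.orderOf_eq]
    · simp [Units.val_mul]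
  · simp
  · intro x y _ _ hx hy
    rw [map_add]
    exact add_mem hx hy
  · intro c x _ hx
    rw [map_smul]
    exact Submodule.smul_mem _ c hx

/-- If `𝓜 = M_{n×n}(k)` then the commutant of the semisimple elements of `H` is `Z`: a matrix
commuting with every semisimple element of `H` commutes with all of `M_{n×n}(k)`, hence is scalar
(Mathlib `Matrix.mem_range_scalar_of_commute_single`).  This is Thorne's remark "in particular, an
adequate subgroup acts absolutely irreducibly" (`End_{k[H]}(kⁿ) = k`).
[cite: Thorne2017TwoAdic, after Def. 2.20] -/
theorem mem_scalarMatrices_of_forall_commute {H : Subgroup (GL (Fin n) k)}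
    (hspan : Subgroup.semisimpleSpan H = ⊤) {M : Matrix (Fin n) (Fin n) k}
    (hM : ∀ h : H, (orderOf (h : GL (Fin n) k)).Coprime (ringChar k) →
      Commute (((h : GL (Fin n) k)) : Matrix (Fin n) (Fin n) k) M) :
    M ∈ scalarMatrices (Fin n) k := by
  -- every matrix commutes with `M`
  have hall : ∀ A : Matrix (Fin n) (Fin n) k, Commute A M := by
    intro A
    have hA : A ∈ Subgroup.semisimpleSpan H := hspan ▸ Submodule.mem_top
    rw [Subgroup.semisimpleSpan] at hA
    refine Submodule.span_induction (p := fun A _ => Commute A M) ?_ ?_ ?_ ?_ hA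
    · rintro _ ⟨h, hh, rfl⟩
      exact hM h hh
    · exact Commute.zero_left M
    · intro x y _ _ hx hy
      exact hx.add_left hy
    · intro c x _ hx
      exact hx.smul_left c
  obtain ⟨c, hc⟩ := Matrix.mem_range_scalar_of_commute_single (M := M) fun i j _ => hall _
  rw [mem_scalarMatrices_iff]
  exact ⟨c, by rw [← hc, Matrix.scalar_apply, Matrix.smul_one_eq_diagonal]⟩

/-! ### Extended adequacy (GHT 2017, §1) -/

/-- **`H ≤ GL_n(k)` is adequate in the extended sense** of Guralnick–Herzig–Tiep 2017, §1 (the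
three clauses verbatim; the notion of Thorne's later papers, allowing `p ∣ n` and `p = 2`).  With
`p = ringChar k`, `ad = M_{n×n}(k)` under `h • M = h M h⁻¹`, `Z = k · 1` and `ad₀ = ad/Z`
(`Subgroup.adModScalarRep H`):
* `addMonoidHom_eq_zero` — (i) `H¹(H, k) = 0` (trivial action; `H¹ = Hom(H, k)`): every additive
  homomorphism `H → k` vanishes;
* `cocycles₁_le_coboundaries₁` — (ii) `H¹(H, (V* ⊗ V)/k) = H¹(H, ad/Z) = 0`: every inhomogeneous
  `1`-cocycle `H → ad₀` is a `1`-coboundary (Mathlib `groupCohomology.cocycles₁`, `coboundaries₁`;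
  elementwise: `cocycles₁_le_coboundaries₁_iff_forall`);
* `semisimpleSpan_eq_top` — (iii) "`End(V)` is spanned by the elements `ρ(g)` with `ρ(g)`
  semisimple": the `k`-span of the elements of `H` of order prime to `p` is all of `M_{n×n}(k)`.
GHT state the definition for an absolutely irreducible `H`; this is not made a clause (it follows
from (iii), `IsExtendedAdequate.invariants_adRep_eq`; module docstring, "Design").  Thorne's printed
Def. 2.20 replaces (iii) by an eigenprojection condition on the simple submodules of `ad`
(`Subgroup.IsThorne2017Adequate`), which implies (iii).  Declared as
`….GaloisRepresentations.Subgroup.IsExtendedAdequate` (topic namespace, not Mathlib's `Subgroup`).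
[cite: GuralnickHerzigTiep2017, §1 (definition of adequate, arXiv p. 3); Thorne2017TwoAdic, Def. 2.20] -/
structure Subgroup.IsExtendedAdequate (H : Subgroup (GL (Fin n) k)) : Prop where
  /-- (i) `H¹(H, k) = 0` for the trivial action: `Hom(H, k) = 0`. -/
  addMonoidHom_eq_zero : ∀ f : Additive H →+ k, f = 0
  /-- (ii) `H¹(H, ad/Z) = 0`. -/
  cocycles₁_le_coboundaries₁ :
    groupCohomology.cocycles₁ (Rep.of (Subgroup.adModScalarRep H)) ≤
      groupCohomology.coboundaries₁ (Rep.of (Subgroup.adModScalarRep H))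
  /-- (iii) `M_{n×n}(k)` is spanned over `k` by the semisimple (order prime to `p`) elements of
  `H`. -/
  semisimpleSpan_eq_top : Subgroup.semisimpleSpan H = ⊤

/-- Unfolding lemma for `Subgroup.IsExtendedAdequate`. [folklore] -/
theorem Subgroup.isExtendedAdequate_iff (H : Subgroup (GL (Fin n) k)) :
    Subgroup.IsExtendedAdequate H ↔
      (∀ f : Additive H →+ k, f = 0) ∧
      groupCohomology.cocycles₁ (Rep.of (Subgroup.adModScalarRep H)) ≤
        groupCohomology.coboundaries₁ (Rep.of (Subgroup.adModScalarRep H)) ∧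
      Subgroup.semisimpleSpan H = ⊤ :=
  ⟨fun h => ⟨h.1, h.2, h.3⟩, fun h => ⟨h.1, h.2.1, h.2.2⟩⟩

/-- **Elementwise form of "`H¹ = 0`"** in Mathlib's inhomogeneous model, for any representation
`A` of a group `G`: every `1`-cocycle (`f (g h) = g • f h + f g`) is a `1`-coboundary
(`f g = g • m − m` for some `m`).  Used to check clause (ii) by hand. [folklore] -/
theorem cocycles₁_le_coboundaries₁_iff_forall {G : Type u} [Group G] (A : Rep k G) :
    groupCohomology.cocycles₁ A ≤ groupCohomology.coboundaries₁ A ↔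
      ∀ f : G → A, (∀ g h : G, f (g * h) = A.ρ g (f h) + f g) →
        ∃ m : A, ∀ g : G, f g = A.ρ g m - m := by
  constructor
  · intro hle f hf
    have hmem : f ∈ groupCohomology.coboundaries₁ A :=
      hle ((groupCohomology.mem_cocycles₁_iff f).2 hf)
    obtain ⟨m, hm⟩ := (LinearMap.mem_range).1 hmem
    refine ⟨m, fun g => ?_⟩
    rw [← hm, groupCohomology.d₀₁_hom_apply]
  · intro h f hf
    obtain ⟨m, hm⟩ := h f ((groupCohomology.mem_cocycles₁_iff f).1 hf)
    refine (LinearMap.mem_range).2 ⟨m, ?_⟩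
    funext g
    rw [groupCohomology.d₀₁_hom_apply, hm g]

namespace Subgroup.IsExtendedAdequate

variable {H : Subgroup (GL (Fin n) k)}

/-- Clause (i) in Mathlib's group cohomology: for an adequate `H`, `H¹(H, k)`
(`groupCohomology.H1` of the trivial representation `Rep.trivial k H k`) is zero, by Mathlib's
`H¹(G, A) ≅ Hom(G, A)` for trivial `A` (`groupCohomology.H1IsoOfIsTrivial`). [folklore] -/
theorem subsingleton_H1_trivial (hH : Subgroup.IsExtendedAdequate H) :
    Subsingleton (groupCohomology.H1 (Rep.trivial k H k)) := by
  haveI : Subsingleton (Additive H →+ k) :=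
    ⟨fun f g => by rw [hH.addMonoidHom_eq_zero f, hH.addMonoidHom_eq_zero g]⟩
  exact (groupCohomology.H1IsoOfIsTrivial (Rep.trivial k H k)).toLinearEquiv.injective.subsingleton

/-- Clause (ii) in Mathlib's group cohomology: for an adequate `H`, `H¹(H, ad/Z)`
(`groupCohomology.H1`) is zero (every class is represented by a cocycle, `H1_induction_on`, and a
cocycle maps to `0` iff it is a coboundary, `H1π_eq_zero_iff`). [folklore] -/
theorem subsingleton_H1 (hH : Subgroup.IsExtendedAdequate H) :
    Subsingleton (groupCohomology.H1 (Rep.of (Subgroup.adModScalarRep H))) := by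
  refine ⟨fun x y => ?_⟩
  have h0 : ∀ z : groupCohomology.H1 (Rep.of (Subgroup.adModScalarRep H)), z = 0 := by
    intro z
    induction z using groupCohomology.H1_induction_on with
    | h f =>
      rw [groupCohomology.H1π_eq_zero_iff]
      exact hH.cocycles₁_le_coboundaries₁ f.2
  rw [h0 x, h0 y]

/-- Clause (ii) elementwise: every `1`-cocycle `H → ad/Z` is of the form `h ↦ h • m − m`.
[folklore] -/
theorem exists_eq_sub_of_cocycle (hH : Subgroup.IsExtendedAdequate H)
    (f : H → Matrix (Fin n) (Fin n) k ⧸ scalarMatrices (Fin n) k)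
    (hf : ∀ g h : H, f (g * h) = Subgroup.adModScalarRep H g (f h) + f g) :
    ∃ m : Matrix (Fin n) (Fin n) k ⧸ scalarMatrices (Fin n) k,
      ∀ g : H, f g = Subgroup.adModScalarRep H g m - m :=
  (cocycles₁_le_coboundaries₁_iff_forall (Rep.of (Subgroup.adModScalarRep H))).1
    hH.cocycles₁_le_coboundaries₁ f hf

/-- Clause (i) multiplicatively: every homomorphism from an adequate `H` to the additive group of
`k` (written `Multiplicative k`) is trivial. [folklore] -/
theorem monoidHom_eq_one (hH : Subgroup.IsExtendedAdequate H) (f : H →* Multiplicative k) :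
    f = 1 := by
  have h := hH.addMonoidHom_eq_zero (MonoidHom.toAdditiveLeft f)
  ext x
  have hx := DFunLike.congr_fun h (Additive.ofMul x)
  simpa using hx

/-- Clause (iii) pointwise: every matrix is a `k`-linear combination of semisimple elements of an
adequate `H`. [folklore] -/
theorem mem_semisimpleSpan (hH : Subgroup.IsExtendedAdequate H) (M : Matrix (Fin n) (Fin n) k) :
    M ∈ Subgroup.semisimpleSpan H :=
  hH.semisimpleSpan_eq_top ▸ Submodule.mem_top

/-- **"In particular, an adequate subgroup acts absolutely irreducibly"**: a matrix commuting with
an adequate `H` is scalar (`End_{k[H]}(kⁿ) = k`). [cite: Thorne2017TwoAdic, after Def. 2.20] -/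
theorem mem_scalarMatrices_of_forall_commute (hH : Subgroup.IsExtendedAdequate H)
    {M : Matrix (Fin n) (Fin n) k}
    (hM : ∀ h : H, Commute (((h : GL (Fin n) k)) : Matrix (Fin n) (Fin n) k) M) :
    M ∈ scalarMatrices (Fin n) k :=
  GaloisRepresentations.mem_scalarMatrices_of_forall_commute hH.semisimpleSpan_eq_top
    fun h _ => hM h

/-- **`H⁰(H, ad) = Z`** for an adequate `H`: the `H`-invariants of the adjoint representation are
exactly the scalar matrices (Thorne, proof of Prop. 2.21: "`ad r̄(1)^{G_{F_N}} = k` (i.e. the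
subspace of scalar matrices)"). [cite: Thorne2017TwoAdic, after Def. 2.20 and proof of Prop. 2.21] -/
theorem invariants_adRep_eq (hH : Subgroup.IsExtendedAdequate H) :
    (Subgroup.adRep H).invariants = scalarMatrices (Fin n) k := by
  refine le_antisymm (fun M hM => ?_) (fun M hM => ?_)
  · refine hH.mem_scalarMatrices_of_forall_commute fun h => ?_
    have hfix := (Representation.mem_invariants _ M).1 hM h
    rw [Subgroup.adRep_apply] at hfix
    -- `h M h⁻¹ = M` ⇒ `h M = M h`
    have e := congrArg (· * (((h : GL (Fin n) k)) : Matrix (Fin n) (Fin n) k)) hfix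
    simp only [Matrix.mul_assoc, Units.inv_mul, Matrix.mul_one] at e
    exact e
  · exact (Representation.mem_invariants _ M).2 fun h =>
      glAdjointRepresentation_apply_of_mem_scalarMatrices (h : GL (Fin n) k) hM

end Subgroup.IsExtendedAdequate

/-! ### Thorne's printed form (Math. Z. 2017, Def. 2.20) -/

/-- **`H ≤ GL_n(k)` is adequate in the sense of Thorne, Math. Z. 285 (2017), Def. 2.20** (clauses
verbatim; "semi-simple" in the GHTT sense "of order prime to `p`").  With `p = ringChar k`,
`ad = M_{n×n}(k)` under conjugation (`Subgroup.adRep H`), `ad₀ = ad/Z` (`Subgroup.adModScalarRep H`)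
and `e_{h,α}` the `h`-equivariant projection onto the generalised `α`-eigenspace
(`eigenprojectionMatrix`):
* `addMonoidHom_eq_zero`, `cocycles₁_le_coboundaries₁` — (i) "`H¹(H, K) = 0` and `H¹(H, ad₀) = 0`";
* `exists_trace_eigenprojection_ne_zero` — (ii) "for each simple `K[H]`-submodule `W ⊂ ad`, there
  exists a semi-simple element `σ ∈ H` with an eigenvalue `α ∈ K` such that `tr e_{σ,α} W ≠ 0`": for
  every atom `W` of the lattice of subrepresentations of `ad` there are `h ∈ H` of order prime to
  `p`, `α ∈ k` and `w ∈ W` with `tr(e_{h,α} w) ≠ 0` (`α` is then automatically an eigenvalue of `h`,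
  `hasEigenvalue_of_trace_eigenprojectionMatrix_mul_ne_zero`).
"The second condition implies that `M_n(K)` is spanned as a `K`-vector space by the semi-simple
elements `σ ∈ H ⊂ ad`" (i.e. `Subgroup.IsExtendedAdequate`; a separate result).
[cite: Thorne2017TwoAdic, Def. 2.20] -/
structure Subgroup.IsThorne2017Adequate (H : Subgroup (GL (Fin n) k)) : Prop where
  /-- (i, first half) `H¹(H, k) = 0` for the trivial action: `Hom(H, k) = 0`. -/
  addMonoidHom_eq_zero : ∀ f : Additive H →+ k, f = 0
  /-- (i, second half) `H¹(H, ad₀) = 0`. -/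
  cocycles₁_le_coboundaries₁ :
    groupCohomology.cocycles₁ (Rep.of (Subgroup.adModScalarRep H)) ≤
      groupCohomology.coboundaries₁ (Rep.of (Subgroup.adModScalarRep H))
  /-- (ii) every simple `k[H]`-submodule `W ⊆ ad` satisfies `tr(e_{h,α} W) ≠ 0` for some semisimple
  `h ∈ H` and some `α ∈ k`. -/
  exists_trace_eigenprojection_ne_zero :
    ∀ W : Subrepresentation (Subgroup.adRep H), IsAtom W →
      ∃ h : H, (orderOf (h : GL (Fin n) k)).Coprime (ringChar k) ∧ ∃ α : k, ∃ w ∈ W,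
        (eigenprojectionMatrix (((h : GL (Fin n) k)) : Matrix (Fin n) (Fin n) k) α * w).trace ≠ 0

/-- Unfolding lemma for `Subgroup.IsThorne2017Adequate`. [folklore] -/
theorem Subgroup.isThorne2017Adequate_iff (H : Subgroup (GL (Fin n) k)) :
    Subgroup.IsThorne2017Adequate H ↔
      (∀ f : Additive H →+ k, f = 0) ∧
      groupCohomology.cocycles₁ (Rep.of (Subgroup.adModScalarRep H)) ≤
        groupCohomology.coboundaries₁ (Rep.of (Subgroup.adModScalarRep H)) ∧
      ∀ W : Subrepresentation (Subgroup.adRep H), IsAtom W →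
        ∃ h : H, (orderOf (h : GL (Fin n) k)).Coprime (ringChar k) ∧ ∃ α : k, ∃ w ∈ W,
          (eigenprojectionMatrix (((h : GL (Fin n) k)) : Matrix (Fin n) (Fin n) k) α * w).trace
            ≠ 0 :=
  ⟨fun h => ⟨h.1, h.2, h.3⟩, fun h => ⟨h.1, h.2.1, h.2.2⟩⟩

namespace Subgroup.IsThorne2017Adequate

variable {H : Subgroup (GL (Fin n) k)}

/-- Clause (i), first half, in Mathlib's group cohomology: `H¹(H, k) = 0`. [folklore] -/
theorem subsingleton_H1_trivial (hH : Subgroup.IsThorne2017Adequate H) :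
    Subsingleton (groupCohomology.H1 (Rep.trivial k H k)) := by
  haveI : Subsingleton (Additive H →+ k) :=
    ⟨fun f g => by rw [hH.addMonoidHom_eq_zero f, hH.addMonoidHom_eq_zero g]⟩
  exact (groupCohomology.H1IsoOfIsTrivial (Rep.trivial k H k)).toLinearEquiv.injective.subsingleton

/-- Clause (i), second half, in Mathlib's group cohomology: `H¹(H, ad₀) = 0`. [folklore] -/
theorem subsingleton_H1 (hH : Subgroup.IsThorne2017Adequate H) :
    Subsingleton (groupCohomology.H1 (Rep.of (Subgroup.adModScalarRep H))) := by
  refine ⟨fun x y => ?_⟩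
  have h0 : ∀ z : groupCohomology.H1 (Rep.of (Subgroup.adModScalarRep H)), z = 0 := by
    intro z
    induction z using groupCohomology.H1_induction_on with
    | h f =>
      rw [groupCohomology.H1π_eq_zero_iff]
      exact hH.cocycles₁_le_coboundaries₁ f.2
  rw [h0 x, h0 y]

/-- In clause (ii) the witness `α` is an eigenvalue of `h` and `w ≠ 0`. [folklore] -/
theorem exists_hasEigenvalue (hH : Subgroup.IsThorne2017Adequate H)
    (W : Subrepresentation (Subgroup.adRep H)) (hW : IsAtom W) :
    ∃ h : H, (orderOf (h : GL (Fin n) k)).Coprime (ringChar k) ∧ ∃ α : k,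
      Module.End.HasEigenvalue (Matrix.toLin' (((h : GL (Fin n) k)) : Matrix (Fin n) (Fin n) k)) α ∧
        ∃ w ∈ W, w ≠ 0 ∧
          (eigenprojectionMatrix (((h : GL (Fin n) k)) : Matrix (Fin n) (Fin n) k) α * w).trace
            ≠ 0 := by
  obtain ⟨h, hh, α, w, hw, htr⟩ := hH.exists_trace_eigenprojection_ne_zero W hW
  refine ⟨h, hh, α, hasEigenvalue_of_trace_eigenprojectionMatrix_mul_ne_zero htr, w, hw, ?_, htr⟩
  rintro rfl
  exact htr (by rw [Matrix.mul_zero, Matrix.trace_zero])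

end Subgroup.IsThorne2017Adequate

end Subgroup

/-! ### Dot-form for framed representations -/

section Framed

variable {G : Type*} [Group G] [TopologicalSpace G] {k : Type u} [Field k] [TopologicalSpace k]
  {n : ℕ}

/-- A framed representation `ρ : G →ₜ* GL_n(k)` **has extended-adequate image** if the subgroup
`ρ(G) ≤ GL_n(k)` is adequate in the extended sense (`Subgroup.IsExtendedAdequate`).  Thorne's
Thm. 5.1 assumes "the group `ρ̄(G_{F(ζ_p)}) ⊂ GL_n(𝔽̄_p)` is adequate", i.e. this property of the
restriction of the residual representation `ρ̄` to `G_{F(ζ_p)}`.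
[cite: Thorne2017TwoAdic, Thm. 5.1 (ii); GuralnickHerzigTiep2017, §1] -/
def FramedRep.HasExtendedAdequateImage (ρ : FramedRep G k n) : Prop :=
  Subgroup.IsExtendedAdequate ρ.toMonoidHom.range

/-- Unfolding lemma for `FramedRep.HasExtendedAdequateImage`. [folklore] -/
theorem FramedRep.hasExtendedAdequateImage_iff (ρ : FramedRep G k n) :
    ρ.HasExtendedAdequateImage ↔ Subgroup.IsExtendedAdequate ρ.toMonoidHom.range :=
  Iff.rfl

end Framed

/-! ### `e_{f,α}` is a polynomial in `f` -/

section EigenprojectionPolynomial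

open Polynomial

variable {K : Type*} [Field K] {V : Type*} [AddCommGroup V] [Module K V] [FiniteDimensional K V]

/-- Characterisation of `e_{f,α} x` by the Fitting decomposition: if `y` lies in the generalised
`α`-eigenspace and `x - y` in the Fitting complement, then `e_{f,α} x = y`. [folklore] -/
theorem eigenprojection_eq_of_mem {f : Module.End K V} {α : K} {x y : V}
    (hy : y ∈ ⨆ m : ℕ, LinearMap.ker ((f - α • 1) ^ m))
    (hxy : x - y ∈ ⨅ m : ℕ, LinearMap.range ((f - α • 1) ^ m)) :
    eigenprojection f α x = y := by
  have hx : x = y + (x - y) := by abel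
  rw [hx, map_add, eigenprojection_apply, eigenprojection_apply,
    Submodule.projection_apply_of_mem_left _ hy, Submodule.projection_apply_of_mem_right _ hxy,
    add_zero]

/-- **`e_{f,α}` is a polynomial in `f`**: writing the minimal polynomial of `f` as `(X − α)^m q`
with `q(α) ≠ 0` and `a (X − α)^m + b q = 1` (Bézout), one has `e_{f,α} = (b q)(f)`.  (This is why
`e_{g,α} W ⊆ W` for a `k[H]`-submodule `W` and `g ∈ H`, and why `e_{g,α}` lies in the span of the
powers of `g`.) [folklore] -/
theorem exists_eigenprojection_eq_aeval (f : Module.End K V) (α : K) :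
    ∃ p : K[X], eigenprojection f α = aeval f p := by
  set μ : K[X] := minpoly K f with hμdef
  have hμ0 : μ ≠ 0 := minpoly.ne_zero (Algebra.IsIntegral.isIntegral f)
  have hμf : aeval f μ = 0 := minpoly.aeval K f
  set m : ℕ := μ.rootMultiplicity α with hmdef
  set q : K[X] := μ /ₘ (X - C α) ^ m with hqdef
  have hfac : (X - C α) ^ m * q = μ := pow_mul_divByMonic_rootMultiplicity_eq μ α
  have hqα : q.eval α ≠ 0 := eval_divByMonic_pow_rootMultiplicity_ne_zero α hμ0
  -- `(X - α)^j` and `q` are coprime for every `j`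
  have hcop : ∀ j : ℕ, IsCoprime ((X - C α) ^ j) q := fun j => by
    refine IsCoprime.pow_left ((irreducible_X_sub_C α).coprime_iff_not_dvd.2 ?_)
    rw [dvd_iff_isRoot]
    exact hqα
  -- `((X - α)^j)(f) = (f - α)^j`
  have hpow : ∀ j : ℕ, aeval f ((X - C α) ^ j) = (f - α • 1) ^ j := fun j => by
    rw [map_pow, map_sub, aeval_X, aeval_C, Algebra.algebraMap_eq_smul_one]
  obtain ⟨a, b, hab⟩ := hcop m
  refine ⟨b * q, LinearMap.ext fun x => eigenprojection_eq_of_mem ?_ ?_⟩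
  · -- `(b q)(f) x` is killed by `(f - α)^m`, since `(X - α)^m b q = b μ`
    refine Submodule.mem_iSup_of_mem m (LinearMap.mem_ker.2 ?_)
    have e1 : (X - C α) ^ m * (b * q) = b * μ := by rw [← hfac]; ring
    rw [← hpow, ← Module.End.mul_apply, ← map_mul, e1, map_mul, Module.End.mul_apply, hμf,
      LinearMap.zero_apply, map_zero]
  · -- `x - (b q)(f) x = (a (X - α)^m)(f) x` lies in every `range (f - α)^j`: it is killed by
    -- `q(f)`, on whose kernel `f - α` is invertible (`c (X - α)^j + d q = 1`)
    have hz : x - aeval f (b * q) x = aeval f (a * (X - C α) ^ m) x := by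
      have e2 : a * (X - C α) ^ m = 1 - b * q := by rw [← hab]; ring
      rw [e2, map_sub, map_one, LinearMap.sub_apply, Module.End.one_apply]
    rw [hz, Submodule.mem_iInf]
    intro j
    obtain ⟨c, d, hcd⟩ := hcop j
    refine LinearMap.mem_range.2 ⟨aeval f (c * a * (X - C α) ^ m) x, ?_⟩
    have e3 : a * (X - C α) ^ m = (X - C α) ^ j * (c * a * (X - C α) ^ m) + d * a * μ := by
      rw [← hfac]
      linear_combination (-(a * (X - C α) ^ m)) * hcd
    rw [← hpow j, ← Module.End.mul_apply, ← map_mul, e3, map_add, LinearMap.add_apply,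
      map_mul (aeval f) (d * a) μ, Module.End.mul_apply, hμf, LinearMap.zero_apply, map_zero,
      add_zero]

variable {ι : Type*} [Fintype ι] [DecidableEq ι]

omit [FiniteDimensional K V] in
/-- **`e_{A,α}` is a polynomial in the matrix `A`.** [folklore] -/
theorem exists_eigenprojectionMatrix_eq_aeval (A : Matrix ι ι K) (α : K) :
    ∃ p : K[X], eigenprojectionMatrix A α = aeval A p := by
  obtain ⟨p, hp⟩ := exists_eigenprojection_eq_aeval (Matrix.toLin' A) α
  refine ⟨p, ?_⟩
  have h : aeval (Matrix.toLin' A) p = Matrix.toLin' (aeval A p) :=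
    aeval_algHom_apply (Matrix.toLinAlgEquiv' (R := K) (n := ι)) A p
  rw [eigenprojectionMatrix, hp, h, LinearMap.toMatrix'_toLin']

/-- **Spectral decomposition of a diagonalisable endomorphism**: if the eigenspaces of `f` span `V`
then `f = ∑_{μ ∈ S} μ e_{f,μ}` for the (finite) set `S` of roots of the minimal polynomial.
[folklore] -/
theorem exists_eq_sum_smul_eigenprojection (f : Module.End K V)
    (hdiag : ⨆ μ : K, f.eigenspace μ = ⊤) :
    ∃ S : Finset K, f = ∑ μ ∈ S, μ • eigenprojection f μ := by
  classical
  refine ⟨(minpoly K f).roots.toFinset, LinearMap.ext fun x => ?_⟩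
  have hx : x ∈ ⨆ μ : K, f.eigenspace μ := hdiag ▸ Submodule.mem_top
  refine Submodule.iSup_induction _
    (motive := fun x => f x = (∑ μ ∈ (minpoly K f).roots.toFinset, μ • eigenprojection f μ) x)
    hx ?_ ?_ ?_
  · intro μ x hxμ
    have hxμ' : f x = μ • x := Module.End.mem_eigenspace_iff.1 hxμ
    by_cases hx0 : x = 0
    · simp [hx0]
    have hμ : μ ∈ (minpoly K f).roots.toFinset := by
      rw [Multiset.mem_toFinset, mem_roots (minpoly.ne_zero (Algebra.IsIntegral.isIntegral f))]
      exact Module.End.isRoot_of_hasEigenvalue (Module.End.hasEigenvalue_of_hasEigenvector ⟨hxμ, hx0⟩)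
    rw [LinearMap.sum_apply, Finset.sum_eq_single_of_mem μ hμ, LinearMap.smul_apply,
      eigenprojection_apply_of_apply_eq_smul hxμ', hxμ']
    intro μ' _ hne
    rw [LinearMap.smul_apply, eigenprojection_apply_of_apply_eq_smul_of_ne hxμ' hne.symm, smul_zero]
  · simp
  · intro x y hx hy
    rw [map_add, map_add, hx, hy]

omit [FiniteDimensional K V] in
/-- Matrix form of the spectral decomposition: if `A` is diagonalisable over `K` then
`A = ∑_{μ ∈ S} μ e_{A,μ}` for some finite `S ⊆ K`, hence `tr(A w) = ∑_{μ ∈ S} μ tr(e_{A,μ} w)`.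
[folklore] -/
theorem exists_trace_mul_eq_sum (A : Matrix ι ι K)
    (hdiag : ⨆ μ : K, Module.End.eigenspace (Matrix.toLin' A) μ = ⊤) :
    ∃ S : Finset K, ∀ w : Matrix ι ι K,
      (A * w).trace = ∑ μ ∈ S, μ * (eigenprojectionMatrix A μ * w).trace := by
  obtain ⟨S, hS⟩ := exists_eq_sum_smul_eigenprojection (Matrix.toLin' A) hdiag
  have hA : A = ∑ μ ∈ S, μ • eigenprojectionMatrix A μ := by
    have h := congrArg LinearMap.toMatrix' hS
    rw [LinearMap.toMatrix'_toLin', map_sum] at h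
    refine h.trans (Finset.sum_congr rfl fun μ _ => ?_)
    rw [map_smul, eigenprojectionMatrix]
  refine ⟨S, fun w => ?_⟩
  conv_lhs => rw [hA]
  rw [Finset.sum_mul, Matrix.trace_sum]
  refine Finset.sum_congr rfl fun μ _ => ?_
  rw [Matrix.smul_mul, Matrix.trace_smul, smul_eq_mul]

end EigenprojectionPolynomial

/-! ### Thorne's remark: Def. 2.20 (ii) ⇒ the semisimple elements span `M_n(k)`; the converse -/

section Bridge

variable {k : Type u} [Field k] {n : ℕ}

/-- Powers of a semisimple element of `H` lie in `𝓜` (their orders divide its order). [folklore] -/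
theorem Subgroup.pow_mem_semisimpleSpan (H : Subgroup (GL (Fin n) k)) (h : H)
    (hh : (orderOf (h : GL (Fin n) k)).Coprime (ringChar k)) (j : ℕ) :
    (((h : GL (Fin n) k)) : Matrix (Fin n) (Fin n) k) ^ j ∈ Subgroup.semisimpleSpan H := by
  have hj : (orderOf ((h ^ j : H) : GL (Fin n) k)).Coprime (ringChar k) := by
    rw [Subgroup.coe_pow]
    exact Nat.Coprime.coprime_dvd_left (orderOf_pow_dvd j) hh
  have hmem := Subgroup.mem_semisimpleSpan_of_coprime H (h ^ j) hj
  rwa [Subgroup.coe_pow, Units.val_pow_eq_pow_val] at hmem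

/-- A polynomial in a semisimple element of `H` lies in `𝓜`. [folklore] -/
theorem Subgroup.aeval_mem_semisimpleSpan (H : Subgroup (GL (Fin n) k)) (h : H)
    (hh : (orderOf (h : GL (Fin n) k)).Coprime (ringChar k)) (p : Polynomial k) :
    Polynomial.aeval (((h : GL (Fin n) k)) : Matrix (Fin n) (Fin n) k) p ∈
      Subgroup.semisimpleSpan H := by
  rw [Polynomial.aeval_eq_sum_range]
  exact Submodule.sum_mem _ fun j _ =>
    Submodule.smul_mem _ _ (Subgroup.pow_mem_semisimpleSpan H h hh j)

/-- `e_{h,α} ∈ 𝓜` for a semisimple `h ∈ H` and any `α` (`e_{h,α}` is a polynomial in `h`).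
[folklore] -/
theorem Subgroup.eigenprojectionMatrix_mem_semisimpleSpan (H : Subgroup (GL (Fin n) k)) (h : H)
    (hh : (orderOf (h : GL (Fin n) k)).Coprime (ringChar k)) (α : k) :
    eigenprojectionMatrix (((h : GL (Fin n) k)) : Matrix (Fin n) (Fin n) k) α ∈
      Subgroup.semisimpleSpan H := by
  obtain ⟨p, hp⟩ :=
    exists_eigenprojectionMatrix_eq_aeval (((h : GL (Fin n) k)) : Matrix (Fin n) (Fin n) k) α
  rw [hp]
  exact Subgroup.aeval_mem_semisimpleSpan H h hh p

/-- The trace-orthogonal `𝓜^⊥ = {w | tr(m w) = 0 for all m ∈ 𝓜}` is a `k[H]`-submodule of `ad`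
(`𝓜` being stable under conjugation by `H`). [folklore] -/
theorem Subgroup.exists_subrepresentation_semisimpleSpan_orth (H : Subgroup (GL (Fin n) k)) :
    ∃ W₀ : Subrepresentation (Subgroup.adRep H), ∀ w : Matrix (Fin n) (Fin n) k,
      w ∈ W₀ ↔ ∀ m ∈ Subgroup.semisimpleSpan H, (m * w).trace = 0 := by
  refine ⟨⟨⟨⟨⟨{w | ∀ m ∈ Subgroup.semisimpleSpan H, (m * w).trace = 0}, ?_⟩, ?_⟩, ?_⟩, ?_⟩,
    fun w => Iff.rfl⟩
  · intro a b ha hb m hm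
    rw [Matrix.mul_add, Matrix.trace_add, ha m hm, hb m hm, add_zero]
  · intro m _
    rw [Matrix.mul_zero, Matrix.trace_zero]
  · intro c w hw m hm
    change (m * (c • w)).trace = 0
    rw [Matrix.mul_smul, Matrix.trace_smul, hw m hm, smul_zero]
  · intro g w hw m hm
    change ∀ m ∈ Subgroup.semisimpleSpan H, (m * w).trace = 0 at hw
    -- `tr(m · g w g⁻¹) = tr(g⁻¹ m g · w)` and `g⁻¹ m g ∈ 𝓜`
    have hm' := hw _ (Subgroup.adRep_apply_mem_semisimpleSpan H g⁻¹ hm)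
    rw [Subgroup.adRep_apply, Subgroup.coe_inv, inv_inv] at hm'
    rw [Subgroup.adRep_apply, ← Matrix.mul_assoc, Matrix.trace_mul_comm, ← Matrix.mul_assoc,
      ← Matrix.mul_assoc]
    exact hm'

/-- In a finite-dimensional representation every non-zero subrepresentation contains a simple one
(an atom of the lattice of subrepresentations, which is well-founded). [folklore] -/
theorem Subrepresentation.exists_isAtom_le {G : Type*} [Group G] {V : Type*} [AddCommGroup V]
    [Module k V] [FiniteDimensional k V] {ρ : Representation k G V} (W : Subrepresentation ρ)
    (hW : W ≠ ⊥) : ∃ a : Subrepresentation ρ, IsAtom a ∧ a ≤ W := by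
  haveI : WellFoundedLT (Subrepresentation ρ) :=
    (OrderEmbedding.ofMapLEIff (fun W : Subrepresentation ρ => W.toSubmodule)
      fun _ _ => Iff.rfl).wellFoundedLT
  haveI : IsAtomic (Subrepresentation ρ) := isAtomic_of_orderBot_wellFounded_lt wellFounded_lt
  exact (eq_bot_or_exists_atom_le W).resolve_left hW

/-- A non-zero subrepresentation contains a non-zero vector. [folklore] -/
theorem Subrepresentation.exists_mem_ne_zero {G : Type*} [Group G] {V : Type*} [AddCommGroup V]
    [Module k V] {ρ : Representation k G V} (W : Subrepresentation ρ) (hW : W ≠ ⊥) :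
    ∃ w ∈ W, w ≠ 0 := by
  by_contra hcon
  push Not at hcon
  apply hW
  apply Subrepresentation.toSubmodule_injective
  change W.toSubmodule = ⊥
  rw [eq_bot_iff]
  intro w hw
  exact (Submodule.mem_bot k).2 (hcon w hw)

/-- If `𝓜 ≠ M_{n×n}(k)` then `𝓜^⊥ ≠ 0`: `𝓜^⊥` is the kernel of `w ↦ (m ↦ tr(m w)) : ad → 𝓜^∨`
and `dim 𝓜^∨ = dim 𝓜 < dim ad`. [folklore] -/
theorem Subgroup.exists_ne_zero_semisimpleSpan_orth (H : Subgroup (GL (Fin n) k))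
    (hM : Subgroup.semisimpleSpan H ≠ ⊤) :
    ∃ w : Matrix (Fin n) (Fin n) k, w ≠ 0 ∧
      ∀ m ∈ Subgroup.semisimpleSpan H, (m * w).trace = 0 := by
  let Φ : Matrix (Fin n) (Fin n) k →ₗ[k] Module.Dual k (Subgroup.semisimpleSpan H) :=
    LinearMap.mk₂ k
      (fun (w : Matrix (Fin n) (Fin n) k) (m : Subgroup.semisimpleSpan H) =>
        ((m : Matrix (Fin n) (Fin n) k) * w).trace)
      (fun w₁ w₂ m => by simp only [Matrix.mul_add, Matrix.trace_add])
      (fun c w m => by simp only [Matrix.mul_smul, Matrix.trace_smul])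
      (fun w m₁ m₂ => by simp only [Submodule.coe_add, Matrix.add_mul, Matrix.trace_add])
      (fun c w m => by simp only [Submodule.coe_smul, Matrix.smul_mul, Matrix.trace_smul])
  have hker : LinearMap.ker Φ ≠ ⊥ := by
    refine LinearMap.ker_ne_bot_of_finrank_lt ?_
    rw [Subspace.dual_finrank_eq]
    exact Submodule.finrank_lt hM
  obtain ⟨w, hw, hw0⟩ := (Submodule.ne_bot_iff _).1 hker
  refine ⟨w, hw0, fun m hm => ?_⟩
  have h := LinearMap.congr_fun (LinearMap.mem_ker.1 hw) ⟨m, hm⟩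
  simpa [Φ] using h

namespace Subgroup.IsThorne2017Adequate

variable {H : Subgroup (GL (Fin n) k)}

/-- **Thorne's remark after Def. 2.20: "The second condition implies that `M_n(K)` is spanned as a
`K`-vector space by the semi-simple elements `σ ∈ H ⊂ ad`."**  (If not, the trace-orthogonal of the
span is a non-zero `k[H]`-submodule of `ad`, so contains a simple `W`; but `e_{σ,α}` is a polynomial
in `σ`, hence lies in the span, so `tr e_{σ,α} W = 0` for all semisimple `σ` and all `α`.)
[cite: Thorne2017TwoAdic, after Def. 2.20] -/
theorem semisimpleSpan_eq_top (hH : Subgroup.IsThorne2017Adequate H) :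
    Subgroup.semisimpleSpan H = ⊤ := by
  by_contra hM
  obtain ⟨W₀, hW₀⟩ := Subgroup.exists_subrepresentation_semisimpleSpan_orth H
  obtain ⟨w₀, hw₀0, hw₀⟩ := Subgroup.exists_ne_zero_semisimpleSpan_orth H hM
  have hne : W₀ ≠ ⊥ := by
    intro hbot
    have hmem : w₀ ∈ W₀ := (hW₀ w₀).2 hw₀
    rw [hbot] at hmem
    exact hw₀0 ((Submodule.mem_bot k).1 hmem)
  obtain ⟨W, hWatom, hWle⟩ := Subrepresentation.exists_isAtom_le W₀ hne
  obtain ⟨h, hh, α, w, hw, htr⟩ := hH.exists_trace_eigenprojection_ne_zero W hWatom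
  exact htr ((hW₀ w).1 (hWle hw) _ (Subgroup.eigenprojectionMatrix_mem_semisimpleSpan H h hh α))

/-- **Thorne's Def. 2.20 implies extended adequacy in the form of Guralnick–Herzig–Tiep, §1.**
[cite: Thorne2017TwoAdic, after Def. 2.20] -/
theorem isExtendedAdequate (hH : Subgroup.IsThorne2017Adequate H) :
    Subgroup.IsExtendedAdequate H :=
  ⟨hH.addMonoidHom_eq_zero, hH.cocycles₁_le_coboundaries₁, hH.semisimpleSpan_eq_top⟩

/-- "In particular, an adequate subgroup acts absolutely irreducibly": a matrix commuting with `H`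
is scalar. [cite: Thorne2017TwoAdic, after Def. 2.20] -/
theorem mem_scalarMatrices_of_forall_commute (hH : Subgroup.IsThorne2017Adequate H)
    {M : Matrix (Fin n) (Fin n) k}
    (hM : ∀ h : H, Commute (((h : GL (Fin n) k)) : Matrix (Fin n) (Fin n) k) M) :
    M ∈ scalarMatrices (Fin n) k :=
  hH.isExtendedAdequate.mem_scalarMatrices_of_forall_commute hM

end Subgroup.IsThorne2017Adequate

namespace Subgroup.IsExtendedAdequate

variable {H : Subgroup (GL (Fin n) k)}

/-- **Converse: GHT's span condition implies Thorne's clause (ii)** whenever every semisimple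
element of `H` is diagonalisable over `k` (e.g. `k` algebraically closed, or `k` containing the
`m`-th roots of unity for the orders `m` of the elements of `H`).  (A simple `W ∋ w ≠ 0` has
`tr(σ w) ≠ 0` for some semisimple `σ ∈ H` by non-degeneracy of the trace form and the span
condition, and `tr(σ w) = ∑_α α tr(e_{σ,α} w)`.) [folklore] -/
theorem isThorne2017Adequate (hH : Subgroup.IsExtendedAdequate H)
    (hdiag : ∀ h : H, (orderOf (h : GL (Fin n) k)).Coprime (ringChar k) →
      ⨆ μ : k, Module.End.eigenspace
        (Matrix.toLin' ((((h : GL (Fin n) k)) : Matrix (Fin n) (Fin n) k))) μ = ⊤) :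
    Subgroup.IsThorne2017Adequate H where
  addMonoidHom_eq_zero := hH.addMonoidHom_eq_zero
  cocycles₁_le_coboundaries₁ := hH.cocycles₁_le_coboundaries₁
  exists_trace_eigenprojection_ne_zero W hW := by
    obtain ⟨w, hw, hw0⟩ := Subrepresentation.exists_mem_ne_zero W hW.1
    -- some semisimple `h ∈ H` has `tr(h w) ≠ 0`
    have hex : ∃ h : H, (orderOf (h : GL (Fin n) k)).Coprime (ringChar k) ∧
        ((((h : GL (Fin n) k)) : Matrix (Fin n) (Fin n) k) * w).trace ≠ 0 := by
      by_contra hcon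
      push Not at hcon
      have hall : ∀ m : Matrix (Fin n) (Fin n) k, (m * w).trace = 0 := by
        intro m
        have hm : m ∈ Subgroup.semisimpleSpan H := hH.mem_semisimpleSpan m
        rw [Subgroup.semisimpleSpan] at hm
        refine Submodule.span_induction (p := fun m _ => (m * w).trace = 0) ?_ ?_ ?_ ?_ hm
        · rintro _ ⟨h, hh, rfl⟩
          exact hcon h hh
        · rw [Matrix.zero_mul, Matrix.trace_zero]
        · intro x y _ _ hx hy
          rw [Matrix.add_mul, Matrix.trace_add, hx, hy, add_zero]
        · intro c x _ hx
          rw [Matrix.smul_mul, Matrix.trace_smul, hx, smul_zero]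
      apply hw0
      ext i j
      have hij := hall (Matrix.single j i 1)
      rwa [Matrix.trace_single_mul, one_smul] at hij
    obtain ⟨h, hh, htr⟩ := hex
    obtain ⟨S, hS⟩ := exists_trace_mul_eq_sum _ (hdiag h hh)
    rw [hS w] at htr
    obtain ⟨μ, -, hμ⟩ := Finset.exists_ne_zero_of_sum_ne_zero htr
    exact ⟨h, hh, μ, w, hw, fun h0 => hμ (by rw [h0, mul_zero])⟩

end Subgroup.IsExtendedAdequate

/-- Over an algebraically closed field, an element of `GL_n(k)` of order prime to `p = ringChar k`
is diagonalisable: it is killed by the separable polynomial `X^m − 1`, `m` its order, hence is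
semisimple (Mathlib `Module.End.isSemisimple_of_squarefree_aeval_eq_zero`), and the eigenspaces of
a semisimple endomorphism over `k = k̄` span (Mathlib `Module.End.IsSemisimple.iSup_eigenspace_eq_top`).
[folklore] -/
theorem iSup_eigenspace_eq_top_of_coprime_orderOf [IsAlgClosed k] (g : GL (Fin n) k)
    (hg : (orderOf g).Coprime (ringChar k)) :
    ⨆ μ : k, Module.End.eigenspace (Matrix.toLin' ((g : GL (Fin n) k) : Matrix (Fin n) (Fin n) k)) μ
      = ⊤ := by
  set m : ℕ := orderOf g with hmdef
  -- `m ≠ 0` in `k`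
  have hm : (m : k) ≠ 0 := by
    intro h0
    have hdvd : ringChar k ∣ m := (ringChar.spec k m).1 h0
    have h1 : ringChar k ∣ 1 := by
      have h2 : ringChar k ∣ Nat.gcd m (ringChar k) := Nat.dvd_gcd hdvd (dvd_refl _)
      rwa [Nat.Coprime.gcd_eq_one hg] at h2
    exact CharP.ringChar_ne_one (Nat.dvd_one.1 h1)
  set f := Matrix.toLin' ((g : GL (Fin n) k) : Matrix (Fin n) (Fin n) k) with hfdef
  have hfm : f ^ m = 1 := by
    have h1 : ((g : GL (Fin n) k) : Matrix (Fin n) (Fin n) k) ^ m = 1 := by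
      rw [← Units.val_pow_eq_pow_val, pow_orderOf_eq_one, Units.val_one]
    have h2 := congrArg (Matrix.toLinAlgEquiv' (R := k) (n := Fin n)) h1
    rw [map_pow, map_one] at h2
    exact h2
  have haeval : Polynomial.aeval f (Polynomial.X ^ m - Polynomial.C (1 : k)) = 0 := by
    rw [map_sub, map_pow, Polynomial.aeval_X, Polynomial.aeval_C, map_one, hfm, sub_self]
  have hsep : (Polynomial.X ^ m - Polynomial.C (1 : k)).Separable :=
    Polynomial.separable_X_pow_sub_C (1 : k) hm one_ne_zero
  exact (Module.End.isSemisimple_of_squarefree_aeval_eq_zero hsep.squarefree haeval)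
    |>.iSup_eigenspace_eq_top

/-- **Over an algebraically closed field (e.g. `𝔽̄_p`, the setting of Thorne's Thm. 5.1) Thorne's
printed Def. 2.20 and the Guralnick–Herzig–Tiep form agree.**
[cite: Thorne2017TwoAdic, Def. 2.20 and the remark after it; GuralnickHerzigTiep2017, §1] -/
theorem Subgroup.isThorne2017Adequate_iff_isExtendedAdequate [IsAlgClosed k]
    (H : Subgroup (GL (Fin n) k)) :
    Subgroup.IsThorne2017Adequate H ↔ Subgroup.IsExtendedAdequate H :=
  ⟨fun hH => hH.isExtendedAdequate,
    fun hH => hH.isThorne2017Adequate fun g hg =>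
      iSup_eigenspace_eq_top_of_coprime_orderOf (g : GL (Fin n) k) hg⟩

end Bridge

end Literature.NumberTheory.GaloisRepresentations
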